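import Literature.GroupTheory.CombinatorialGroupTheory.QuadraticWordsEngine
import Mathlib.Data.List.Rotate
import HarnessLib

/-!
# Zieschang's Nielsen reduction of a binary product, cyclic form

Topic `Literature/GroupTheory/CombinatorialGroupTheory`.  The cancellation engine of
`QuadraticWordsEngine.lean` (H. Zieschang, *Alternierende Produkte in freien Gruppen* (1964);
Zieschang–Vogt–Coldewey, LNM 835 (1980), §5.2, Thm. 5.2.6: *"For each binary product there is
a related binary product with the [Nielsen] properties"*) run for an ARBITRARY value and in
CYCLIC form.

A *state* is an alternating quadratic word `w` over the symbols `ι` together with an assignment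
`X : ι → F` of its symbols in a free group (`X̂ = FreeGroup.lift X`); the letters `x` of `w`,
read cyclically, carry the values `X̂(x)`.  The state is **cyclically reduced**
(`CyclicallyReduced`) if every rotation of the sequence of values has the Nielsen property of
`QuadraticWordsCollapse.lean` (`LocallyReduced`: no value is `1`, at most half of each of two
cyclically consecutive values cancels between them, and no value has exactly its two halves
cancelled by its two cyclic neighbours).  A symbol is *inessential* (ZVC 5.2.5) if its two
letters are cyclically adjacent in `w`.

* `exists_step_of_not_locallyReduced`, `exists_related_zMeasure_lt` — **one step**: if no
  letter of `w` has trivial value, no symbol is inessential and the state is not cyclically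
  reduced, a rotation followed by one transport move (`exists_move_absorb_right/left`) gives a
  related state (a permutation `w'` of `w` and an automorphism `ψ` of `F(ι)` with `ψ(w')`
  conjugate to `w`) whose transformed assignment `X̂ ∘ ψ` has smaller measure `zMeasure`
  (total length, then total left-half weight);
* `exists_related_cyclicallyReduced` — **Zieschang's reduction** (ZVC Thm. 5.2.6, cyclic
  form): every state is related to one which has a symbol of trivial value, or an inessential
  symbol, or is cyclically reduced;
* `exists_related_cyclicallyReduced'`, `exists_related_zMeasure_lt'` — the same for values in
  the free group on an arbitrary finite alphabet `β` (transport along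
  `FreeGroup.freeGroupCongr (Fintype.equivFin β)`; the Nielsen property is invariant under a
  relabelling of the letters: `locallyReduced_map_freeGroupCongr_iff`,
  `cyclicallyReduced_map_freeGroupCongr_iff`, `norm_freeGroupCongr`,
  `maxCancel_toWord_freeGroupCongr`).

## References

* H. Zieschang, *Alternierende Produkte in freien Gruppen*, Abh. Math. Sem. Univ. Hamburg 27
  (1964) 13–31. [Zieschang1964]
* H. Zieschang, E. Vogt, H.-D. Coldewey, *Surfaces and Planar Discontinuous Groups*, LNM 835
  (1980), §5.2: 5.2.4–5.2.7, proof of Thm. 5.2.8. [ZieschangVogtColdewey1980]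
* R. C. Lyndon, P. E. Schupp, *Combinatorial Group Theory* (2001), Ch. I §2 (proof of Prop. 2.2).
  [LyndonSchupp2001]
-/

namespace Literature.GroupTheory.CombinatorialGroupTheory

open List

/-! ### The cyclic Nielsen property -/

section Cyclic

variable {α : Type*} [DecidableEq α]

/-- **The cyclic Nielsen property** of a cyclic sequence of elements of a free group: every
rotation has the Nielsen property `LocallyReduced` (ZVC 5.2.6 (a),(b), 5.2.7, for the cyclic
neighbours). [cite: ZieschangVogtColdewey1980, 5.2.6–5.2.7] -/
def CyclicallyReduced (L : List (FreeGroup α)) : Prop :=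
  ∀ k, k < L.length → LocallyReduced (L.rotate k)

/-- The empty sequence is cyclically reduced. [folklore] -/
theorem cyclicallyReduced_nil : CyclicallyReduced ([] : List (FreeGroup α)) :=
  fun k hk => absurd hk (Nat.not_lt_zero k)

/-- A nonempty cyclically reduced sequence has the Nielsen property. [folklore] -/
theorem CyclicallyReduced.locallyReduced {L : List (FreeGroup α)} (h : CyclicallyReduced L)
    (hL : L ≠ []) : LocallyReduced L := by
  have := h 0 (length_pos_of_ne_nil hL)
  rwa [rotate_zero] at this

/-- Every rotation of a cyclically reduced sequence is cyclically reduced. [folklore] -/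
theorem CyclicallyReduced.rotate {L : List (FreeGroup α)} (h : CyclicallyReduced L) (j : ℕ) :
    CyclicallyReduced (L.rotate j) := by
  intro k hk
  rw [length_rotate] at hk
  rw [rotate_rotate, ← rotate_mod]
  exact h _ (Nat.mod_lt _ (by omega))

end Cyclic

/-! ### Relabelling the letters -/

section Relabel

variable {β γ : Type*} [DecidableEq β] [DecidableEq γ]

omit [DecidableEq β] [DecidableEq γ] in
/-- An injective relabelling of the letters preserves reducedness of words. [folklore] -/
theorem isReduced_map_iff {f : β → γ} (hf : Function.Injective f) (L : List (β × Bool)) :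
    FreeGroup.IsReduced (L.map fun p => (f p.1, p.2)) ↔ FreeGroup.IsReduced L := by
  unfold FreeGroup.IsReduced
  rw [isChain_map]
  simp only [hf.eq_iff]

/-- The reduced word of a relabelled element is the relabelled reduced word. [folklore] -/
theorem toWord_map_of_injective {f : β → γ} (hf : Function.Injective f) (x : FreeGroup β) :
    (FreeGroup.map f x).toWord = x.toWord.map fun p => (f p.1, p.2) := by
  conv_lhs => rw [← FreeGroup.mk_toWord (x := x), FreeGroup.map.mk, FreeGroup.toWord_mk]
  exact ((isReduced_map_iff hf _).2 FreeGroup.isReduced_toWord).reduce_eq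

/-- An injective relabelling preserves the length. [folklore] -/
theorem norm_map_of_injective {f : β → γ} (hf : Function.Injective f) (x : FreeGroup β) :
    (FreeGroup.map f x).norm = x.norm := by
  simp only [FreeGroup.norm, toWord_map_of_injective hf, length_map]

/-- `freeGroupCongr` preserves the length. [folklore] -/
theorem norm_freeGroupCongr (e : β ≃ γ) (x : FreeGroup β) :
    (FreeGroup.freeGroupCongr e x).norm = x.norm :=
  norm_map_of_injective e.injective x

/-- `freeGroupCongr` preserves the maximal cancellation between two elements. [folklore] -/
theorem maxCancel_toWord_freeGroupCongr (e : β ≃ γ) (x y : FreeGroup β) :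
    maxCancel (FreeGroup.freeGroupCongr e x).toWord (FreeGroup.freeGroupCongr e y).toWord =
      maxCancel x.toWord y.toWord := by
  have h1 := norm_mul_eq (FreeGroup.freeGroupCongr e x) (FreeGroup.freeGroupCongr e y)
  have h2 := norm_mul_eq x y
  rw [← map_mul, norm_freeGroupCongr, norm_freeGroupCongr, norm_freeGroupCongr] at h1
  omega

/-- The Nielsen property descends along a relabelling of the letters. [folklore] -/
theorem LocallyReduced.of_map_freeGroupCongr (e : β ≃ γ) {L : List (FreeGroup β)}
    (h : LocallyReduced (L.map (FreeGroup.freeGroupCongr e))) : LocallyReduced L where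
  ne_one x hx h1 := h.ne_one _ (mem_map_of_mem hx) (by rw [h1, map_one])
  pair P Q x y hL := by
    have := h.pair (P.map (FreeGroup.freeGroupCongr e)) (Q.map (FreeGroup.freeGroupCongr e))
      (FreeGroup.freeGroupCongr e x) (FreeGroup.freeGroupCongr e y) (by rw [hL]; simp)
    rwa [maxCancel_toWord_freeGroupCongr, norm_freeGroupCongr, norm_freeGroupCongr] at this
  triple P Q x y z hL hh := by
    refine h.triple (P.map (FreeGroup.freeGroupCongr e)) (Q.map (FreeGroup.freeGroupCongr e))
      (FreeGroup.freeGroupCongr e x) (FreeGroup.freeGroupCongr e y) (FreeGroup.freeGroupCongr e z)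
      (by rw [hL]; simp) ?_
    rwa [maxCancel_toWord_freeGroupCongr, maxCancel_toWord_freeGroupCongr, norm_freeGroupCongr]

/-- **The Nielsen property is invariant under a relabelling of the letters.** [folklore] -/
theorem locallyReduced_map_freeGroupCongr_iff (e : β ≃ γ) (L : List (FreeGroup β)) :
    LocallyReduced (L.map (FreeGroup.freeGroupCongr e)) ↔ LocallyReduced L := by
  refine ⟨LocallyReduced.of_map_freeGroupCongr e, fun h => ?_⟩
  refine LocallyReduced.of_map_freeGroupCongr e.symm ?_
  rwa [map_map, show (⇑(FreeGroup.freeGroupCongr e.symm) ∘ ⇑(FreeGroup.freeGroupCongr e)) = id from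
    funext fun x => by
      rw [Function.comp_apply, ← FreeGroup.freeGroupCongr_symm]
      exact (FreeGroup.freeGroupCongr e).symm_apply_apply x, map_id]

/-- **The cyclic Nielsen property is invariant under a relabelling of the letters.** [folklore] -/
theorem cyclicallyReduced_map_freeGroupCongr_iff (e : β ≃ γ) (L : List (FreeGroup β)) :
    CyclicallyReduced (L.map (FreeGroup.freeGroupCongr e)) ↔ CyclicallyReduced L := by
  simp only [CyclicallyReduced, length_map, ← map_rotate, locallyReduced_map_freeGroupCongr_iff]

end Relabel

/-! ### One step -/

section Step

variable {ι : Type*} [DecidableEq ι] [Fintype ι] {n : ℕ}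

/-- **One step, linear form.**  Let `X` assign values in a free group to the symbols of the
quadratic word `w` so that no letter of `w` has trivial value and no two adjacent letters of `w`
are partners.  If the sequence of values of the letters of `w` does not have the Nielsen
property, some transport move (with its transvection `ψ`, `ψ(w')` conjugate to `w`) lowers the
measure of the transformed assignment `X̂ ∘ ψ`: a value losing more than half to a neighbour is
absorbed by it (`exists_move_absorb_right/left`), a value losing exactly its two halves is
absorbed by the neighbour dictated by Lyndon–Schupp's left-half weights
(`norm_mul_eq_and_lexWeight_lt_or`). [cite: ZieschangVogtColdewey1980, Thm. 5.2.6 and proof of Thm. 5.2.8] -/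
theorem exists_step_of_not_locallyReduced (w : List (ι × Bool)) (hq : IsQuadratic w)
    (X : ι → FreeGroup (Fin n)) (hne : ∀ x ∈ w, X x.1 ≠ 1)
    (hadj : ∀ (P R : List (ι × Bool)) (x : ι × Bool), w ≠ P ++ x :: (x.1, !x.2) :: R)
    (hnot : ¬ LocallyReduced (w.map fun x => FreeGroup.lift X (sgen x.1 x.2))) :
    ∃ (w' : List (ι × Bool)) (ψ : MulAut (FreeGroup ι)) (c : FreeGroup ι),
      w' ~ w ∧ ψ (FreeGroup.mk w') = c * FreeGroup.mk w * c⁻¹ ∧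
      zMeasure (fun i => FreeGroup.lift X (ψ (FreeGroup.of i))) < zMeasure X := by
  have hval : ∀ x : ι × Bool, FreeGroup.lift X (sgen x.1 x.2) = val X x := fun x => lift_sgen X x
  have hLdef : (w.map fun x => FreeGroup.lift X (sgen x.1 x.2)) = w.map (val X) :=
    map_congr_left fun x _ => hval x
  rw [hLdef] at hnot
  -- the two ways of using a consecutive pair of letters
  have key : ∀ (P Q : List (ι × Bool)) (a b : ι × Bool), w = P ++ a :: b :: Q →
      (∃ (w' : List (ι × Bool)) (ψ : MulAut (FreeGroup ι)) (c : FreeGroup ι),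
        w' ~ w ∧ ψ (FreeGroup.mk w') = c * FreeGroup.mk w * c⁻¹ ∧
        (∀ i, i ≠ a.1 → ψ (FreeGroup.of i) = FreeGroup.of i) ∧
        FreeGroup.lift X (ψ (sgen a.1 a.2)) = val X a * val X b) ∧
      (∃ (w' : List (ι × Bool)) (ψ : MulAut (FreeGroup ι)) (c : FreeGroup ι),
        w' ~ w ∧ ψ (FreeGroup.mk w') = c * FreeGroup.mk w * c⁻¹ ∧
        (∀ i, i ≠ b.1 → ψ (FreeGroup.of i) = FreeGroup.of i) ∧
        FreeGroup.lift X (ψ (sgen b.1 b.2)) = val X a * val X b) := by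
    intro P Q a b hw
    have hw' : w = P ++ a :: ([] ++ b :: Q) := hw
    have hab : (a.1, !a.2) ≠ b := fun h => hadj P Q a (by rw [hw, h])
    have hba : (b.1, !b.2) ≠ a := fun h => hab (by rw [← h, Bool.not_not])
    have hg : FreeGroup.lift X (FreeGroup.mk ([] : List (ι × Bool))) = 1 := by
      rw [show (FreeGroup.mk ([] : List (ι × Bool)) : FreeGroup ι) = 1 from rfl, map_one]
    constructor
    · obtain ⟨w', ψ, c, h1, h2, h3, h4⟩ :=
        exists_move_absorb_right hq hw' (not_mem_nil) hab X hg
      exact ⟨w', ψ, c, h1, h2, h3, by rw [h4, hval, hval]⟩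
    · obtain ⟨w', ψ, c, h1, h2, h3, h4⟩ :=
        exists_move_absorb_left hq hw' (not_mem_nil) hba X hg
      exact ⟨w', ψ, c, h1, h2, h3, by rw [h4, hval, hval]⟩
  -- how a move changes the measure
  have measure_of : ∀ (a : ι × Bool) (m : FreeGroup (Fin n)) (ψ : MulAut (FreeGroup ι)),
      (∀ i, i ≠ a.1 → ψ (FreeGroup.of i) = FreeGroup.of i) →
      FreeGroup.lift X (ψ (sgen a.1 a.2)) = m →
      (m.norm < (val X a).norm ∨ (m.norm = (val X a).norm ∧ lexWeight m < lexWeight (val X a))) →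
      zMeasure (fun i => FreeGroup.lift X (ψ (FreeGroup.of i))) < zMeasure X := by
    intro a m ψ hfix hm hlt
    set X' : ι → FreeGroup (Fin n) := fun i => FreeGroup.lift X (ψ (FreeGroup.of i)) with hX'
    have hX'm : FreeGroup.lift X' (sgen a.1 a.2) = m := by
      have : FreeGroup.lift X' = (FreeGroup.lift X).comp ψ.toMonoidHom :=
        FreeGroup.ext_hom _ _ fun i => by simp [hX']
      rw [this]; exact hm
    obtain ⟨hn, hl⟩ := norm_lexWeight_of_lift_sgen hX'm
    obtain ⟨hn₀, hl₀⟩ := norm_lexWeight_of_lift_sgen (hval a)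
    refine zMeasure_lt_of_single a.1 (fun i hi => by simp [hX', hfix i hi]) ?_
    rw [hn, hl, hn₀, hl₀]
    exact hlt
  -- suppose no move lowers the measure; then the values have the Nielsen property
  by_contra hcon
  apply hnot
  refine ⟨fun x hx => ?_, fun P Q x y hL => ?_, fun P Q x y z hL hh => ?_⟩
  · -- (N0)
    obtain ⟨a, ha, rfl⟩ := mem_map.1 hx
    have := hne a ha
    obtain ⟨i, s⟩ := a
    cases s <;> simpa [val] using this
  · -- (N1) at consecutive letters
    rw [map_eq_append_iff] at hL
    obtain ⟨Pw, rest, hw, -, hrest⟩ := hL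
    rw [map_eq_cons_iff] at hrest
    obtain ⟨a, rest', rfl, hx, hrest'⟩ := hrest
    rw [map_eq_cons_iff] at hrest'
    obtain ⟨b, Qw, rfl, hy, -⟩ := hrest'
    obtain ⟨hR, hL'⟩ := key Pw Qw a b hw
    have hnorm := norm_mul_eq x y
    by_contra hlt
    rw [not_and_or, not_le, not_le] at hlt
    rcases hlt with hlt | hlt
    · -- more than half of `x` cancels: `b` absorbs `a`
      obtain ⟨w', ψ, c, h1, h2, h3, h4⟩ := hL'
      exact hcon ⟨w', ψ, c, h1, h2, measure_of b (x * y) ψ h3 (by rw [h4, hx, hy])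
        (Or.inl (by rw [hy]; omega))⟩
    · -- more than half of `y` cancels: `a` absorbs `b`
      obtain ⟨w', ψ, c, h1, h2, h3, h4⟩ := hR
      exact hcon ⟨w', ψ, c, h1, h2, measure_of a (x * y) ψ h3 (by rw [h4, hx, hy])
        (Or.inl (by rw [hx]; omega))⟩
  · -- (N2) at consecutive letters
    rw [map_eq_append_iff] at hL
    obtain ⟨Pw, rest, hw, -, hrest⟩ := hL
    rw [map_eq_cons_iff] at hrest
    obtain ⟨a, rest', rfl, hx, hrest'⟩ := hrest
    rw [map_eq_cons_iff] at hrest'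
    obtain ⟨b, rest'', rfl, hy, hrest''⟩ := hrest'
    rw [map_eq_cons_iff] at hrest''
    obtain ⟨d, Qw, rfl, hz, -⟩ := hrest''
    obtain ⟨h₁, h₂⟩ := hh
    have hnorm₁ := norm_mul_eq x y
    have hnorm₂ := norm_mul_eq y z
    by_cases hu' : x.norm < 2 * maxCancel x.toWord y.toWord
    · -- then (N1) already fails at `x, y`: `b` absorbs `a`
      obtain ⟨-, hL'⟩ := key Pw (d :: Qw) a b hw
      obtain ⟨w', ψ, c, h1, h2, h3, h4⟩ := hL'
      exact hcon ⟨w', ψ, c, h1, h2, measure_of b (x * y) ψ h3 (by rw [h4, hx, hy])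
        (Or.inl (by rw [hy]; omega))⟩
    by_cases hz' : z.norm < 2 * maxCancel y.toWord z.toWord
    · -- (N1) fails at `y, z`: `b` absorbs `d`
      obtain ⟨hR, -⟩ := key (Pw ++ [a]) Qw b d (by rw [hw]; simp)
      obtain ⟨w', ψ, c, h1, h2, h3, h4⟩ := hR
      exact hcon ⟨w', ψ, c, h1, h2, measure_of b (y * z) ψ h3 (by rw [h4, hy, hz])
        (Or.inl (by rw [hy]; omega))⟩
    -- genuine (N2) failure: Lyndon–Schupp's dichotomy on the left halves
    have hyne : y ≠ 1 := by
      rw [← hy]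
      have := hne b (by rw [hw]; simp)
      obtain ⟨i, s⟩ := b
      cases s <;> simpa [val] using this
    set κ := maxCancel x.toWord y.toWord with hκ
    have hylen : y.toWord.length = 2 * κ := by simp only [FreeGroup.norm] at h₁; omega
    have h₂' : maxCancel y.toWord z.toWord = κ := by omega
    rcases norm_mul_eq_and_lexWeight_lt_or x y z κ hylen hyne rfl h₂'
      (by simp only [FreeGroup.norm] at hu' ⊢; omega)
      (by simp only [FreeGroup.norm] at hz' ⊢; omega) with ⟨hn, hl⟩ | ⟨hn, hl⟩
    · -- `a` absorbs `b`
      obtain ⟨hR, -⟩ := key Pw (d :: Qw) a b hw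
      obtain ⟨w', ψ, c, h1, h2, h3, h4⟩ := hR
      exact hcon ⟨w', ψ, c, h1, h2, measure_of a (x * y) ψ h3 (by rw [h4, hx, hy])
        (Or.inr ⟨by rw [hx]; exact hn, by rw [hx]; exact hl⟩)⟩
    · -- `d` absorbs `b`
      obtain ⟨-, hL'⟩ := key (Pw ++ [a]) Qw b d (by rw [hw]; simp)
      obtain ⟨w', ψ, c, h1, h2, h3, h4⟩ := hL'
      exact hcon ⟨w', ψ, c, h1, h2, measure_of d (y * z) ψ h3 (by rw [h4, hy, hz])
        (Or.inr ⟨by rw [hz]; exact hn, by rw [hz]; exact hl⟩)⟩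

omit [DecidableEq ι] [Fintype ι] in
/-- **Rotation is a legitimate move**: `mk (w.rotate k)` is conjugate to `mk w`. [folklore] -/
theorem mk_rotate_eq_conj (w : List (ι × Bool)) {k : ℕ} (hk : k ≤ w.length) :
    FreeGroup.mk (w.rotate k) =
      (FreeGroup.mk (w.take k))⁻¹ * FreeGroup.mk w * FreeGroup.mk (w.take k) := by
  have h := mk_append_eq_conj (w.take k) (w.drop k)
  rw [take_append_drop] at h
  rw [rotate_eq_drop_append_take hk, h]
  group

omit [DecidableEq ι] [Fintype ι] in
/-- A linear adjacency of partners in a rotation is a cyclic adjacency. [folklore] -/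
theorem rotate_ne_of_forall_rotate_ne {w : List (ι × Bool)} {k : ℕ}
    (hness : ∀ j, j < w.length → ∀ (x : ι × Bool) (R : List (ι × Bool)),
      w.rotate j ≠ x :: (x.1, !x.2) :: R)
    (P R : List (ι × Bool)) (x : ι × Bool) : w.rotate k ≠ P ++ x :: (x.1, !x.2) :: R := by
  intro h
  have hlen : 0 < w.length := by
    rw [← length_rotate w k, h, length_append, length_cons]
    omega
  have h2 : (w.rotate k).rotate P.length = x :: (x.1, !x.2) :: R ++ P := by
    rw [h, rotate_append_length_eq]
  rw [rotate_rotate, ← rotate_mod] at h2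
  exact hness _ (Nat.mod_lt _ hlen) x (R ++ P) (by rw [h2]; simp)

/-- **One step, cyclic form** (the measure decrease, for the minimal-counterexample arguments
of ZVC §5.3).  If no letter of the quadratic word `w` has trivial value, no symbol of `w` is
inessential (its two letters cyclically adjacent) and the cyclic sequence of values is not
cyclically reduced, then a rotation of `w` followed by one transport move gives a permutation
`w'` of `w` and an automorphism `ψ` of `F(ι)` with `ψ(w')` conjugate to `w` such that the
transformed assignment `X̂ ∘ ψ` has smaller measure. [cite: ZieschangVogtColdewey1980, Thm. 5.2.6 and proof of Thm. 5.2.8] -/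
theorem exists_related_zMeasure_lt (w : List (ι × Bool)) (hq : IsQuadratic w)
    (X : ι → FreeGroup (Fin n)) (hne : ∀ x ∈ w, X x.1 ≠ 1)
    (hness : ∀ k, k < w.length → ∀ (x : ι × Bool) (R : List (ι × Bool)),
      w.rotate k ≠ x :: (x.1, !x.2) :: R)
    (hnot : ¬ CyclicallyReduced (w.map fun x => FreeGroup.lift X (sgen x.1 x.2))) :
    ∃ (w' : List (ι × Bool)) (ψ : MulAut (FreeGroup ι)) (c : FreeGroup ι),
      w' ~ w ∧ ψ (FreeGroup.mk w') = c * FreeGroup.mk w * c⁻¹ ∧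
      zMeasure (fun i => FreeGroup.lift X (ψ (FreeGroup.of i))) < zMeasure X := by
  simp only [CyclicallyReduced, not_forall, length_map] at hnot
  obtain ⟨k, hk, hnot⟩ := hnot
  rw [← map_rotate] at hnot
  -- apply the linear step to the rotated word
  obtain ⟨w', ψ, c, hperm, hψ, hlt⟩ := exists_step_of_not_locallyReduced (w.rotate k)
    (hq.perm (rotate_perm w k).symm) X (fun x hx => hne x (mem_rotate.1 hx))
    (rotate_ne_of_forall_rotate_ne hness) hnot
  refine ⟨w', ψ, c * (FreeGroup.mk (w.take k))⁻¹, hperm.trans (rotate_perm w k), ?_, hlt⟩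
  rw [hψ, mk_rotate_eq_conj w hk.le]
  group

end Step

/-! ### The reduction -/

section Reduction

variable {ι : Type*} [DecidableEq ι] [Fintype ι] {n : ℕ}

/-- **Zieschang's Nielsen reduction of a binary product, cyclic form** (ZVC Thm. 5.2.6 and the
first step of the proof of Thm. 5.2.8).  For a quadratic word `w₀` and an assignment `X₀` of its
symbols in a free group there are a permutation `w` of `w₀` and an automorphism `θ` of `F(ι)`
with `θ(w)` conjugate to `w₀` — a related binary product, with transformed assignment
`X = X̂₀ ∘ θ` and the same value up to conjugation — such that: some letter of `w` has trivial
value, or some symbol of `w` is inessential (its two letters are cyclically adjacent), or the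
cyclic sequence of values of the letters of `w` is cyclically Nielsen reduced.
[cite: ZieschangVogtColdewey1980, Thm. 5.2.6] [cite: Zieschang1964] -/
theorem exists_related_cyclicallyReduced (w₀ : List (ι × Bool)) (hq₀ : IsQuadratic w₀)
    (X₀ : ι → FreeGroup (Fin n)) :
    ∃ (w : List (ι × Bool)) (θ : MulAut (FreeGroup ι)) (c : FreeGroup ι),
      w ~ w₀ ∧ θ (FreeGroup.mk w) = c * FreeGroup.mk w₀ * c⁻¹ ∧
      ((∃ x ∈ w, FreeGroup.lift X₀ (θ (FreeGroup.of x.1)) = 1) ∨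
       (∃ k, k < w.length ∧ ∃ (x : ι × Bool) (R : List (ι × Bool)),
          w.rotate k = x :: (x.1, !x.2) :: R) ∨
       CyclicallyReduced (w.map fun x =>
          FreeGroup.lift (fun i => FreeGroup.lift X₀ (θ (FreeGroup.of i))) (sgen x.1 x.2))) := by
  -- well-founded induction on the measure of the transformed assignment
  suffices H : ∀ (m : Lex (ℕ × ℕ)) (w : List (ι × Bool)) (θ : MulAut (FreeGroup ι)) (c : FreeGroup ι),
      w ~ w₀ → θ (FreeGroup.mk w) = c * FreeGroup.mk w₀ * c⁻¹ →
      zMeasure (fun i => FreeGroup.lift X₀ (θ (FreeGroup.of i))) = m →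
      ∃ (w : List (ι × Bool)) (θ : MulAut (FreeGroup ι)) (c : FreeGroup ι),
        w ~ w₀ ∧ θ (FreeGroup.mk w) = c * FreeGroup.mk w₀ * c⁻¹ ∧
        ((∃ x ∈ w, FreeGroup.lift X₀ (θ (FreeGroup.of x.1)) = 1) ∨
         (∃ k, k < w.length ∧ ∃ (x : ι × Bool) (R : List (ι × Bool)),
            w.rotate k = x :: (x.1, !x.2) :: R) ∨
         CyclicallyReduced (w.map fun x =>
            FreeGroup.lift (fun i => FreeGroup.lift X₀ (θ (FreeGroup.of i))) (sgen x.1 x.2))) from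
    H _ w₀ 1 1 (Perm.refl _) (by simp) rfl
  intro m
  refine WellFounded.induction (C := fun m => ∀ (w : List (ι × Bool)) (θ : MulAut (FreeGroup ι))
      (c : FreeGroup ι),
      w ~ w₀ → θ (FreeGroup.mk w) = c * FreeGroup.mk w₀ * c⁻¹ →
      zMeasure (fun i => FreeGroup.lift X₀ (θ (FreeGroup.of i))) = m →
      ∃ (w : List (ι × Bool)) (θ : MulAut (FreeGroup ι)) (c : FreeGroup ι),
        w ~ w₀ ∧ θ (FreeGroup.mk w) = c * FreeGroup.mk w₀ * c⁻¹ ∧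
        ((∃ x ∈ w, FreeGroup.lift X₀ (θ (FreeGroup.of x.1)) = 1) ∨
         (∃ k, k < w.length ∧ ∃ (x : ι × Bool) (R : List (ι × Bool)),
            w.rotate k = x :: (x.1, !x.2) :: R) ∨
         CyclicallyReduced (w.map fun x =>
            FreeGroup.lift (fun i => FreeGroup.lift X₀ (θ (FreeGroup.of i))) (sgen x.1 x.2))))
    wellFounded_lt m ?_
  intro m ih w θ c hperm hθ hm
  set X : ι → FreeGroup (Fin n) := fun i => FreeGroup.lift X₀ (θ (FreeGroup.of i)) with hXdef
  by_cases h1 : ∃ x ∈ w, X x.1 = 1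
  · exact ⟨w, θ, c, hperm, hθ, Or.inl h1⟩
  by_cases h2 : ∃ k, k < w.length ∧ ∃ (x : ι × Bool) (R : List (ι × Bool)),
      w.rotate k = x :: (x.1, !x.2) :: R
  · exact ⟨w, θ, c, hperm, hθ, Or.inr (Or.inl h2)⟩
  by_cases h3 : CyclicallyReduced (w.map fun x => FreeGroup.lift X (sgen x.1 x.2))
  · exact ⟨w, θ, c, hperm, hθ, Or.inr (Or.inr h3)⟩
  -- otherwise a step lowers the measure
  push Not at h1 h2
  obtain ⟨w', ψ, c₁, hperm', hψ, hlt⟩ := exists_related_zMeasure_lt w (hq₀.perm hperm.symm) X h1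
    (fun k hk x R => h2 k hk x R) h3
  have hXhom : FreeGroup.lift X = (FreeGroup.lift X₀).comp θ.toMonoidHom :=
    FreeGroup.ext_hom _ _ fun i => by simp [hXdef]
  have hX' : (fun i => FreeGroup.lift X (ψ (FreeGroup.of i))) =
      fun i => FreeGroup.lift X₀ ((θ * ψ) (FreeGroup.of i)) := by
    funext i
    rw [hXhom, MonoidHom.comp_apply, MulEquiv.coe_toMonoidHom, MulAut.mul_apply]
  rw [hX', hm] at hlt
  exact ih _ hlt w' (θ * ψ) (θ c₁ * c) (hperm'.trans hperm)
    (by rw [MulAut.mul_apply, hψ, map_mul, map_mul, hθ, map_inv]; group) rfl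

end Reduction

/-! ### Values in the free group on an arbitrary finite alphabet -/

section Relabelled

/-- Transport of an assignment along `freeGroupCongr`: the values of `X̂` composed with the
relabelling are the relabelled values. [folklore] -/
theorem lift_comp_freeGroupCongr {ι β γ : Type*} (e : β ≃ γ) (X : ι → FreeGroup β) :
    FreeGroup.lift (fun i => FreeGroup.freeGroupCongr e (X i)) =
      (FreeGroup.freeGroupCongr e).toMonoidHom.comp (FreeGroup.lift X) :=
  FreeGroup.ext_hom _ _ fun i => by simp

variable {ι β : Type*} [DecidableEq ι] [Fintype ι] [DecidableEq β] [Fintype β]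

/-- **One step, cyclic form, for values in `F(β)`**, `β` finite: as
`exists_related_zMeasure_lt`, the measure being that of the relabelled assignment along
`Fintype.equivFin β`. [cite: ZieschangVogtColdewey1980, Thm. 5.2.6 and proof of Thm. 5.2.8] -/
theorem exists_related_zMeasure_lt' (w : List (ι × Bool)) (hq : IsQuadratic w)
    (X : ι → FreeGroup β) (hne : ∀ x ∈ w, X x.1 ≠ 1)
    (hness : ∀ k, k < w.length → ∀ (x : ι × Bool) (R : List (ι × Bool)),
      w.rotate k ≠ x :: (x.1, !x.2) :: R)
    (hnot : ¬ CyclicallyReduced (w.map fun x => FreeGroup.lift X (sgen x.1 x.2))) :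
    ∃ (w' : List (ι × Bool)) (ψ : MulAut (FreeGroup ι)) (c : FreeGroup ι),
      w' ~ w ∧ ψ (FreeGroup.mk w') = c * FreeGroup.mk w * c⁻¹ ∧
      zMeasure (fun i => FreeGroup.freeGroupCongr (Fintype.equivFin β)
          (FreeGroup.lift X (ψ (FreeGroup.of i)))) <
        zMeasure (fun i => FreeGroup.freeGroupCongr (Fintype.equivFin β) (X i)) := by
  set e := Fintype.equivFin β with he
  set X' : ι → FreeGroup (Fin (Fintype.card β)) := fun i => FreeGroup.freeGroupCongr e (X i)
    with hX'
  have hlift : ∀ y, FreeGroup.lift X' y = FreeGroup.freeGroupCongr e (FreeGroup.lift X y) :=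
    fun y => by rw [hX', lift_comp_freeGroupCongr]; rfl
  have hne' : ∀ x ∈ w, X' x.1 ≠ 1 := fun x hx h => by
    have h' : FreeGroup.freeGroupCongr e (X x.1) = 1 := h
    exact hne x hx ((MulEquiv.map_eq_one_iff _).1 h')
  have hnot' : ¬ CyclicallyReduced (w.map fun x => FreeGroup.lift X' (sgen x.1 x.2)) := by
    have : (w.map fun x => FreeGroup.lift X' (sgen x.1 x.2)) =
        (w.map fun x => FreeGroup.lift X (sgen x.1 x.2)).map (FreeGroup.freeGroupCongr e) := by
      rw [map_map]; exact map_congr_left fun x _ => hlift _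
    rwa [this, cyclicallyReduced_map_freeGroupCongr_iff]
  obtain ⟨w', ψ, c, hperm, hψ, hlt⟩ := exists_related_zMeasure_lt w hq X' hne' hness hnot'
  refine ⟨w', ψ, c, hperm, hψ, ?_⟩
  simpa only [hlift] using hlt

/-- **Zieschang's Nielsen reduction, cyclic form, for values in the free group on an arbitrary
finite alphabet** (transport of `exists_related_cyclicallyReduced` along
`FreeGroup.freeGroupCongr (Fintype.equivFin β)`). [cite: ZieschangVogtColdewey1980, Thm. 5.2.6] -/
theorem exists_related_cyclicallyReduced' (w₀ : List (ι × Bool)) (hq₀ : IsQuadratic w₀)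
    (X₀ : ι → FreeGroup β) :
    ∃ (w : List (ι × Bool)) (θ : MulAut (FreeGroup ι)) (c : FreeGroup ι),
      w ~ w₀ ∧ θ (FreeGroup.mk w) = c * FreeGroup.mk w₀ * c⁻¹ ∧
      ((∃ x ∈ w, FreeGroup.lift X₀ (θ (FreeGroup.of x.1)) = 1) ∨
       (∃ k, k < w.length ∧ ∃ (x : ι × Bool) (R : List (ι × Bool)),
          w.rotate k = x :: (x.1, !x.2) :: R) ∨
       CyclicallyReduced (w.map fun x =>
          FreeGroup.lift (fun i => FreeGroup.lift X₀ (θ (FreeGroup.of i))) (sgen x.1 x.2))) := by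
  set e := Fintype.equivFin β with he
  set X₀' : ι → FreeGroup (Fin (Fintype.card β)) := fun i => FreeGroup.freeGroupCongr e (X₀ i)
    with hX₀'
  have hlift : ∀ y, FreeGroup.lift X₀' y = FreeGroup.freeGroupCongr e (FreeGroup.lift X₀ y) :=
    fun y => by rw [hX₀', lift_comp_freeGroupCongr]; rfl
  obtain ⟨w, θ, c, hperm, hθ, htri⟩ := exists_related_cyclicallyReduced w₀ hq₀ X₀'
  refine ⟨w, θ, c, hperm, hθ, ?_⟩
  rcases htri with ⟨x, hx, h1⟩ | h2 | h3
  · refine Or.inl ⟨x, hx, ?_⟩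
    rw [hlift] at h1
    exact (MulEquiv.map_eq_one_iff _).1 h1
  · exact Or.inr (Or.inl h2)
  · refine Or.inr (Or.inr ?_)
    set X : ι → FreeGroup β := fun i => FreeGroup.lift X₀ (θ (FreeGroup.of i)) with hX
    have hfun : (fun i => FreeGroup.lift X₀' (θ (FreeGroup.of i))) =
        fun i => FreeGroup.freeGroupCongr e (X i) := funext fun i => hlift _
    rw [hfun] at h3
    have hlift' : ∀ y, FreeGroup.lift (fun i => FreeGroup.freeGroupCongr e (X i)) y =
        FreeGroup.freeGroupCongr e (FreeGroup.lift X y) :=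
      fun y => by rw [lift_comp_freeGroupCongr]; rfl
    have : (w.map fun x => FreeGroup.lift (fun i => FreeGroup.freeGroupCongr e (X i)) (sgen x.1 x.2)) =
        (w.map fun x => FreeGroup.lift X (sgen x.1 x.2)).map (FreeGroup.freeGroupCongr e) := by
      rw [map_map]; exact map_congr_left fun x _ => hlift' _
    rwa [this, cyclicallyReduced_map_freeGroupCongr_iff] at h3

end Relabelled

end Literature.GroupTheory.CombinatorialGroupTheory
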